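import Summits.AtomisticToContinuum.HydrodynamicLimit.Theorems.InformationPercolationEngineChaosClosesEulerReductionFields
import HarnessLib

/-!
# Kinetic reduction (crux `ChaosClosesEuler`, stmt-AtomisticToContinuum-15141, line `Sketch`,
# stub `stub_kineticReduction`) — helper: coincident velocities are a null event

WHAT. The deterministic BF18 shell of the line clamps the entropy of EXACTLY COLD cone states (all particles of a
cone sharing one velocity) to the lower cut-off; the kinetic reduction prices this clamping by the mass of
single-particle cones, which requires that two distinct particles never share a velocity along the orbit. This file
proves that this holds off a null event:

* `volume_velEq_zero` — in phase space `(𝕋³ × ℝ³)^{N+1}` the coincidence set `{vᵢ = vⱼ}`, `i ≠ j`, is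
  Lebesgue-null (Fubini: a velocity slice is a point of `ℝ³`);
* `measure_coincSet_eq_zero` — the coincidence event (initial data whose orbit has two coincident velocities at
  SOME RATIONAL time) is null for every law absolutely continuous with respect to the Liouville measure (each flow
  map preserves the Liouville measure, which is a restriction of Lebesgue measure);
* `vel_ne_of_not_mem_coincSet` — off this event, velocities are pairwise distinct at EVERY real time: velocities
  are constant on the collision-free stretch following any instant, which contains a rational time.

No named fact is invoked.
-/

noncomputable section

namespace Summit.AtomisticToContinuum.HydrodynamicLimit.Theorems.ChaosClosesEulerReduction

open scoped BigOperators Topology Classical MeasureTheory ENNReal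
open Filter Set MeasureTheory Function
open Literature.MathematicalPhysics.KineticTheory
open Literature.Analysis.FluidPDE
open Summit.AtomisticToContinuum.HydrodynamicLimit.Theorems.LocalSecondLawLedger

variable {N : ℕ}

/-! ## §1 The coincidence set of phase space is Lebesgue-null -/

/-- A velocity slice `{q : 𝕋³ × ℝ³ | q.2 = c}` is Lebesgue-null. [folklore] -/
theorem volume_snd_eq_zero (c : V3) : volume {q : T3 × V3 | q.2 = c} = 0 := by
  have h : {q : T3 × V3 | q.2 = c} = (univ : Set T3) ×ˢ ({c} : Set V3) := by
    ext q; simp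
  rw [h, show (volume : Measure (T3 × V3)) = (volume : Measure T3).prod (volume : Measure V3) from rfl,
    Measure.prod_prod, measure_singleton, mul_zero]

/-- The coincidence set is measurable. [folklore] -/
theorem measurableSet_velEq (i j : Fin (N + 1)) : MeasurableSet {w : Phase N | (w i).2 = (w j).2} :=
  measurableSet_eq_fun ((measurable_pi_apply i).snd) ((measurable_pi_apply j).snd)

/-- **Two distinct particles almost never share a velocity**: `{w | vᵢ = vⱼ}` is Lebesgue-null in phase space for
`i ≠ j`. [folklore] -/
theorem volume_velEq_zero {i j : Fin (N + 1)} (hij : i ≠ j) : volume {w : Phase N | (w i).2 = (w j).2} = 0 := by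
  obtain ⟨k, rfl⟩ := Fin.exists_succAbove_eq hij.symm
  have hmp := @volume_preserving_piFinSuccAbove N (fun _ => T3 × V3) (fun _ => by infer_instance)
    (fun _ => by infer_instance) i
  have hA : {w : Phase N | (w i).2 = (w (i.succAbove k)).2} =
      MeasurableEquiv.piFinSuccAbove (fun _ : Fin (N + 1) => T3 × V3) i ⁻¹' {p | p.1.2 = (p.2 k).2} := by
    ext w
    simp [MeasurableEquiv.piFinSuccAbove_apply, Fin.insertNthEquiv, Fin.removeNth]
  have hB : MeasurableSet {p : (T3 × V3) × (Fin N → T3 × V3) | p.1.2 = (p.2 k).2} :=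
    measurableSet_eq_fun measurable_fst.snd ((measurable_pi_apply k).comp measurable_snd).snd
  rw [hA, hmp.measure_preimage hB.nullMeasurableSet, Measure.volume_eq_prod]
  refine Measure.measure_prod_null_of_ae_null hB (ae_of_all _ fun a => ?_)
  have hs : Prod.mk a ⁻¹' {p : (T3 × V3) × (Fin N → T3 × V3) | p.1.2 = (p.2 k).2} =
      eval k ⁻¹' {q : T3 × V3 | q.2 = a.2} := by
    ext rest; simp [eq_comm]
  simp only [Pi.zero_apply, hs, volume_pi]
  exact @Measure.pi_eval_preimage_null (Fin N) (fun _ => T3 × V3) _ _ (fun _ => (volume : Measure (T3 × V3)))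
    (fun _ => by infer_instance) k _ (volume_snd_eq_zero a.2)

/-! ## §2 The coincidence event of a flow -/

/-- **The coincidence event is null.** The coincidence event of a flow `Φ` — initial data whose orbit has two
distinct particles with the same velocity at some RATIONAL time,
`⋃ q : ℚ, ⋃ i j, {z | i ≠ j ∧ v_i(Φ_q z) = v_j(Φ_q z)}` — is null for every law absolutely continuous with respect to
the Liouville measure. [folklore] -/
theorem measure_coincSet_eq_zero {ε : ℝ} (Φ : HardSphereFlow (Torus.geometry (Fin 3)) ε (N + 1))
    {P : Measure (Phase N)} (hP : P ≪ liouville (Torus.geometry (Fin 3)) (N + 1) ε) :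
    P (⋃ q : ℚ, ⋃ i : Fin (N + 1), ⋃ j : Fin (N + 1), {z : Phase N | i ≠ j ∧ (Φ.flow q z i).2 = (Φ.flow q z j).2}) = 0 := by
  refine measure_iUnion_null fun q => measure_iUnion_null fun i => measure_iUnion_null fun j => ?_
  by_cases hij : i = j
  · have : {z : Phase N | i ≠ j ∧ (Φ.flow q z i).2 = (Φ.flow q z j).2} = ∅ := by
      ext z; simp [hij]
    rw [this, measure_empty]
  have hset : {z : Phase N | i ≠ j ∧ (Φ.flow q z i).2 = (Φ.flow q z j).2} =
      Φ.flow q ⁻¹' {w : Phase N | (w i).2 = (w j).2} := by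
    ext z; simp [hij]
  rw [hset]
  refine hP ?_
  rw [(Φ.measurePreserving q).measure_preimage (measurableSet_velEq i j).nullMeasurableSet, liouville_eq]
  exact le_antisymm ((Measure.restrict_apply_le _ _).trans_eq (volume_velEq_zero hij)) bot_le

/-- **Off the coincidence event, velocities are pairwise distinct at every real time.** [folklore] -/
theorem vel_ne_of_not_mem_coincSet {ε : ℝ} (Φ : HardSphereFlow (Torus.geometry (Fin 3)) ε (N + 1))
    {z : Phase N} (hz : z ∈ Φ.good)
    (hzc : z ∉ ⋃ q : ℚ, ⋃ i : Fin (N + 1), ⋃ j : Fin (N + 1), {z : Phase N | i ≠ j ∧ (Φ.flow q z i).2 = (Φ.flow q z j).2})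
    (s : ℝ) :
    ∀ i j : Fin (N + 1), i ≠ j → (Φ.flow s z i).2 ≠ (Φ.flow s z j).2 := by
  intro i j hij heq
  have hγ := Φ.isTrajectory z hz
  -- the collision-free stretch after `s`
  have hfin : (collisionTimes (Torus.geometry (Fin 3)) ε (fun t => Φ.flow t z) ∩ Icc s (s + 1)).Finite := hγ.locFinite s (s + 1)
  obtain ⟨m, hsm, hm1, hfree⟩ : ∃ m : ℝ, s < m ∧ m ≤ s + 1 ∧
      ∀ τ ∈ Ioo s m, τ ∉ collisionTimes (Torus.geometry (Fin 3)) ε (fun t => Φ.flow t z) := by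
    by_cases hne : (hfin.toFinset.filter fun τ => s < τ).Nonempty
    · refine ⟨(hfin.toFinset.filter fun τ => s < τ).min' hne, ?_, ?_, fun τ hτ hcol => ?_⟩
      · have h := Finset.min'_mem _ hne
        exact (Finset.mem_filter.1 h).2
      · have h := Finset.min'_mem _ hne
        exact ((hfin.mem_toFinset).1 (Finset.mem_filter.1 h).1).2.2
      · have hmem : τ ∈ hfin.toFinset.filter fun τ => s < τ := by
          refine Finset.mem_filter.2 ⟨hfin.mem_toFinset.2 ⟨hcol, hτ.1.le, ?_⟩, hτ.1⟩
          have h := Finset.min'_mem _ hne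
          have := ((hfin.mem_toFinset).1 (Finset.mem_filter.1 h).1).2.2
          exact hτ.2.le.trans this
        exact absurd (Finset.min'_le _ _ hmem) (not_le.2 hτ.2)
    · refine ⟨s + 1, by linarith, le_rfl, fun τ hτ hcol => hne ⟨τ, ?_⟩⟩
      exact Finset.mem_filter.2 ⟨hfin.mem_toFinset.2 ⟨hcol, hτ.1.le, hτ.2.le⟩, hτ.1⟩
  obtain ⟨q, hsq, hqm⟩ := exists_rat_btwn hsm
  have hflight : Φ.flow q z = freeFlight (Torus.geometry (Fin 3)) ((q : ℝ) - s) (Φ.flow s z) :=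
    hγ.free s q hsq.le fun τ hτ => hfree τ ⟨hτ.1, hτ.2.trans_lt hqm⟩
  have hvi : (Φ.flow q z i).2 = (Φ.flow s z i).2 := by rw [hflight]; rfl
  have hvj : (Φ.flow q z j).2 = (Φ.flow s z j).2 := by rw [hflight]; rfl
  exact hzc (mem_iUnion.2 ⟨q, mem_iUnion.2 ⟨i, mem_iUnion.2 ⟨j, hij, by rw [hvi, hvj, heq]⟩⟩⟩)

/-! ## §3 The registered sub-goal -/

/-- **Registered sub-goal `stub_reductionCoincidence` (helper of `stub_kineticReduction`): a velocity slice of the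
one-particle phase space `𝕋³ × ℝ³` is Lebesgue-null** — the Fubini input making coincident velocities of two
distinct hard spheres a null event under every law absolutely continuous with respect to the Liouville measure.
[folklore] -/
theorem stub_reductionCoincidence : ∀ c : V3, MeasureTheory.volume {q : T3 × V3 | q.2 = c} = 0 :=
  fun c => volume_snd_eq_zero c

end Summit.AtomisticToContinuum.HydrodynamicLimit.Theorems.ChaosClosesEulerReduction

end
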